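import Literature.NumberTheory.ComplexMultiplication.CMAlgebraTorusSimpleSubalgebraCommutant
import Literature.Geometry.Kaehler.ComplexTorusRosatiStableCMAlgebra
import Literature.RingTheory.SimpleModule.CommutantAdjointStableMaximalEtale
import Literature.RingTheory.CentralSimple.MaximalEtaleSubalgebraReducedDegree
import HarnessLib

/-!
# Complex multiplication relative to a simple `L ⊆ End_ℚ(X)` STABLE UNDER A ROSATI INVOLUTION: the commutant of
# `L` in `End_ℚ(X)` contains a ROSATI-STABLE étale subalgebra of dimension `2 dim X / d` (Milne, *Complex
# Multiplication*, Ch. I §3 Exercise 3.10 (b)) — torus level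

Family `hodge`, lane `lit-hodgefound` (Track 2 foundations library; skeleton seat `lit-hodgefound-skel-3`, generation
62, row **A3-G147** «Milne CM Ex. 3.10 (b) for a general simple `L`»), layer `Literature/NumberTheory/ComplexMultiplication`,
namespace `Literature.NumberTheory.ComplexMultiplication`.  FILE 3 of the row, at TORUS LEVEL: `X = E/P(ℤ^ι)` a complex
torus, `H₁(X, ℚ) = ℚ^ι` (`2 dim X = #ι`), `End_ℚ(X) = endAlgRat P ⊆ M_ι(ℚ)`, `A ↦ A† = rosati G A = G⁻¹ ᵗA G` the Rosati
involution of a non-degenerate alternating rational `G` (every polarisation).  Sequel, BY NAME, of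

* A3-G143 FILE 2 `CMAlgebraTorusSimpleSubalgebraCommutant` (Ex. 3.10 (a) for every torus: the bound
  `d·dim R ≤ 2 dim X`, «CM ⟹ equality», «equality ⟹ CM») and FILE 1 `RingTheory/CentralSimple/ReducedDegreeCentralizerSimpleSubalgebra`
  (`Matrix.mul_reducedDegree_centralizer_eq_card`: `d·[C(L) : ℚ]_red = 2 dim X`);
* A3-G137 FILE 2 `Geometry/Kaehler/ComplexTorusRosatiStableCMAlgebra` (the case `L = ℚ`) and its tools
  (`centralizer_eq_self_of_comm_isReduced`, `jMatrix_mem_span_centralizer_endAlgRat`, `centralizer_le_endAlgRat_of_jMatrix_mem_span`);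
* A3-G144 `RingTheory/CentralSimple/MaximalEtaleSubalgebraReducedDegree` (`finrank_eq_reducedDegree_and_center_le_of_maximal_of_isSimpleRing`:
  a maximal étale subalgebra of a SIMPLE algebra has degree `[·]_red`);
* this row's FILE 2 `RingTheory/SimpleModule/CommutantAdjointStableMaximalEtale` (the adjoint-stable maximal étale
  subalgebra of `End_S(V)` for a NON-commutative adjointable `S`) and FILE 1 (Cimprič's Lemma 5);
* the tree's `SimpleModule.isSemisimpleRing_baseChange` (Pierce §10.7) and Mathlib's `IsArtinianRing.equivPi`,
  `Algebra.TensorProduct.piRight`, `Algebra.TensorProduct.lift`.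

THEOREMS ONLY (no definition, no instance, no named fact; net debt 0, D-0026).

## The print

J. S. Milne, *Complex Multiplication* (course notes v0.10, 2020) [MilneCM2006], Ch. I §3 p. 29 (open text
`paper:url-8ccc30e4daab`, p0029), VERBATIM: «EXERCISE 3.10 Let `L` be a simple `ℚ`-algebra of finite degree `d²` over
its centre `F`, and let `A` be an abelian variety containing `L` in its endomorphism algebra.  (a) Show that for any
semisimple commutative `ℚ`-subalgebra `R` of `End⁰_L(A)`, `dim_ℚ R ≤ (2 dim A)/d`, and that equality holds for some `R`
if and only [if] `A` has complex multiplication.  (b) Let `′` be a Rosati involution on `End⁰(A)` stabilizing `L`; show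
that, if `A` has complex multiplication, then there is an `R` as in (a) that is stabilized by `′`.»

## Reading (torus level; «semisimple commutative» = commutative reduced)

As in A3-G143: `End⁰_L` = `End_{ℚ,L}(X) := endAlgRat P ⊓ C(L)`; «`X` has complex multiplication» = `End_ℚ(X)`
contains a commutative reduced `T` of dimension `#ι = 2 dim X` (⟺ `[End_ℚ(X) : ℚ]_red = 2 dim X`, A3-G141
`reducedDegree_endAlgRat_eq_card_iff_exists_comm_isReduced`); «a Rosati involution `′` on `End⁰(A)` stabilizing `L`»
= `A ↦ rosati G A` for a rational `G` with `ᵗG = -G`, `det G ≠ 0`, under which `End_ℚ(X)` AND `L` are stable (every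
polarisation gives such a `G` with `End_ℚ(X)` stable: Lange's Lemma 2.4.1, the tree's `rosati_mem_endAlgRat`).
PROOF.  Under CM the rational commutant `Z = C(End_ℚ X)` is commutative, reduced, `†`-stable, with `C(Z) ⊆ End_ℚ(X)`
(`J ∈ Z ⊗ ℝ`; A3-G137); the algebra `S = ℚ[Z ∪ L]` generated by `Z` and `L` is `†`-stable and SEMISIMPLE (a quotient of
`L ⊗_ℚ Z`, semisimple since `Z ≅ ∏ Kⱼ` is a product of fields and `Kⱼ ⊗_ℚ L` is semisimple in characteristic `0`), so
`H₁(X, ℚ)` is a semisimple `S`-module and `S` acts by `†`-adjointable operators for `B(x, y) = ᵗx G y`; FILE 2 gives a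
`†`-STABLE commutative reduced `R ⊆ End_S = C(S) = End_{ℚ,L}(X)`, maximal commutative in `End_S`; `R ⊇ Z` (maximality), so
an element of `C(L)` commuting with `R` commutes with `S`, i.e. `R` is a MAXIMAL étale subalgebra of the SIMPLE algebra
`C(L)` (Voight 7.7.8); by A3-G144 `dim R = [C(L) : ℚ]_red`, and `d·[C(L) : ℚ]_red = #ι` (A3-G143).

## What is formalised (`P : (ι → ℝ) ≃L[ℝ] E`; `L ≤ M_ι(ℚ)` simple with `[L : ℚ] = d²·[Z(L) : ℚ]`)

* §1 ★ **`isSemisimpleRing_tensorProduct_of_comm_isReduced`** — for a field `F` of characteristic `0`, a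
  finite-dimensional semisimple `F`-algebra `B` and a finite-dimensional commutative reduced `F`-algebra `Z`, the
  algebra `B ⊗_F Z` is semisimple (Pierce: separable ⊗ separable is separable; over a perfect field separable =
  finite-dimensional semisimple); `isSemisimpleRing_adjoin_union_of_comm_isReduced` (the subalgebra generated by a
  semisimple `B ⊆ A` and a commutative reduced `Z ⊆ A` commuting with `B` is semisimple).
* §2 ★★★ **`exists_rosati_stable_le_endAlgRat_inf_centralizer_mul_finrank_eq_card`** — EX. 3.10 (b) FOR EVERY COMPLEX
  TORUS: `G` rational alternating non-degenerate with `End_ℚ(X)` `†`-stable, `X` of CM type, `L ≤ End_ℚ(X)` simple of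
  degree `d` over its centre and `†`-STABLE ⟹ there is a commutative reduced `R ≤ End_{ℚ,L}(X)` with
  `d · dim_ℚ R = #ι = 2 dim X` which is `†`-STABLE («there is an `R` as in (a) that is stabilized by `′`»);
  `…_of_reducedDegree_eq_card` (CM as `[End_ℚ(X) : ℚ]_red = 2 dim X`); the iff
  `exists_rosati_stable_mul_finrank_eq_card_iff_reducedDegree_endAlgRat_eq_card`.
* §3 the polarised forms: **`IsRiemannForm.exists_rosati_stable_le_endAlgRat_inf_centralizer_mul_finrank_eq_card`**
  (`(X, η)` polarised, ANY rational Gram matrix `G` of `η`, `L` `†_η`-stable).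

## References

* [MilneCM2006] J. S. Milne, *Complex Multiplication* (2006/2020), Ch. I §3 Exercise 3.10 (a)(b) (p. 29); Prop. 3.6
  (c) (p. 28); §1 Props. 1.2–1.3 (p. 9), Prop. 1.39 (p. 20).
* [Cimpric2008FormallyRealInvolutions] J. Cimprič, *Formally real involutions on central simple algebras*, Comm.
  Algebra 36 (2008) 165–178, §2 Lemma 5.
* [Pierce1982] R. S. Pierce, *Associative Algebras*, GTM 88 (1982), §10.5 Corollary (tensor products of separable
  algebras), §10.7 Cor. b (perfect field: separable ⟺ finite-dimensional semisimple).
* [Voight2021] J. Voight, *Quaternion Algebras*, GTM 288 (2021), §7.7 Prop. 7.7.8 (a).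
* [Lange2023AbelianVarietiesComplex] H. Lange, *Abelian Varieties over the Complex Numbers* (2023), §2.4.1 Lemma 2.4.1,
  Prop. 2.4.2 (a); §7.2.3 Prop. 7.2.6.

## Provenance

Lane `lit-hodgefound`, seat `literature-prover-lit-hodgefound-skel-3-g62-0` (row A3-G147, FILE 3).
-/

noncomputable section

open scoped TensorProduct Classical
open Module Matrix

namespace Literature.NumberTheory.ComplexMultiplication

open Literature.RingTheory.CentralSimple
open Literature.RingTheory.SimpleModule
open Literature.Geometry.Kaehler
open Literature.Geometry.Kaehler.ComplexTorus

/-! ## §1 `B ⊗_F Z` is semisimple for `B` semisimple and `Z` commutative reduced (characteristic `0`) -/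

section TensorSemisimple

/-- ★ **A finite-dimensional semisimple algebra tensored with a finite-dimensional commutative reduced algebra is
semisimple (characteristic `0`)**: `Z ≅ ∏ⱼ Kⱼ` (fields, `IsArtinianRing.equivPi`), so
`B ⊗_F Z ≅ ∏ⱼ B ⊗_F Kⱼ` (`Algebra.TensorProduct.piRight`), and each `Kⱼ ⊗_F B` is semisimple in characteristic `0`
(the tree's `SimpleModule.isSemisimpleRing_baseChange`, Pierce §10.7).  The case «separable ⊗ separable is separable».
[cite: Pierce1982, §10.5 Corollary (tensor products of separable algebras) and §10.7 Cor. b] -/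
theorem isSemisimpleRing_tensorProduct_of_comm_isReduced (F : Type*) [Field F] [CharZero F]
    (B : Type*) [Ring B] [Algebra F B] [Module.Finite F B] [IsSemisimpleRing B]
    (Z : Type*) [CommRing Z] [Algebra F Z] [IsReduced Z] [Module.Finite F Z] :
    IsSemisimpleRing (B ⊗[F] Z) := by
  classical
  haveI : IsArtinianRing Z := IsArtinianRing.of_finite F Z
  let e : Z ≃ₐ[F] (Π I : MaximalSpectrum Z, Z ⧸ I.asIdeal) := (IsArtinianRing.equivPi Z).restrictScalars F
  letI : Fintype (MaximalSpectrum Z) := Fintype.ofFinite _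
  haveI : ∀ I : MaximalSpectrum Z, IsSemisimpleRing (B ⊗[F] (Z ⧸ I.asIdeal)) := fun I ↦ by
    letI : Field (Z ⧸ I.asIdeal) := Ideal.Quotient.field I.asIdeal
    haveI := Literature.RingTheory.SimpleModule.isSemisimpleRing_baseChange F B (Z ⧸ I.asIdeal)
    exact (Algebra.TensorProduct.comm F (Z ⧸ I.asIdeal) B).toRingEquiv.isSemisimpleRing
  let e' : B ⊗[F] Z ≃ₐ[F] Π I : MaximalSpectrum Z, B ⊗[F] (Z ⧸ I.asIdeal) :=
    (Algebra.TensorProduct.congr AlgEquiv.refl e).trans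
      (Algebra.TensorProduct.piRight F F B (fun I : MaximalSpectrum Z ↦ Z ⧸ I.asIdeal))
  exact e'.symm.toRingEquiv.isSemisimpleRing

/-- **The subalgebra generated by a semisimple `B ⊆ A` and a commutative reduced `Z ⊆ A` commuting with `B` is
semisimple** (a quotient of `B ⊗_F Z`), and equals the image of `B ⊗_F Z`. [cite: Pierce1982, §10.5 Prop. c (ii) and Corollary] -/
theorem isSemisimpleRing_adjoin_union_of_comm_isReduced {F : Type*} [Field F] [CharZero F] {A : Type*} [Ring A]
    [Algebra F A] [FiniteDimensional F A] (B : Subalgebra F A) [IsSemisimpleRing B] (Z : Subalgebra F A)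
    [IsReduced Z] (hZcomm : ∀ x ∈ Z, ∀ y ∈ Z, x * y = y * x) (hBZ : ∀ b ∈ B, ∀ z ∈ Z, b * z = z * b) :
    IsSemisimpleRing ↥(Algebra.adjoin F ((B : Set A) ∪ (Z : Set A))) := by
  classical
  letI : CommRing ↥Z := { (inferInstance : Ring ↥Z) with mul_comm := fun x y ↦ Subtype.ext (hZcomm x x.2 y y.2) }
  set φ : ↥B ⊗[F] ↥Z →ₐ[F] A := Algebra.TensorProduct.lift B.val Z.val (fun b z ↦ hBZ b b.2 z z.2) with hφ
  haveI : IsSemisimpleRing (↥B ⊗[F] ↥Z) := isSemisimpleRing_tensorProduct_of_comm_isReduced F ↥B ↥Z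
  have hrange : φ.range = Algebra.adjoin F ((B : Set A) ∪ (Z : Set A)) := by
    apply le_antisymm
    · have hall : ∀ y, φ y ∈ Algebra.adjoin F ((B : Set A) ∪ (Z : Set A)) := by
        intro y
        induction y using TensorProduct.induction_on with
        | zero => rw [map_zero]; exact Subalgebra.zero_mem _
        | tmul b z =>
          rw [hφ, Algebra.TensorProduct.lift_tmul]
          exact Subalgebra.mul_mem _ (Algebra.subset_adjoin (Or.inl b.2)) (Algebra.subset_adjoin (Or.inr z.2))
        | add x y hx hy => rw [map_add]; exact Subalgebra.add_mem _ hx hy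
      intro x hx
      obtain ⟨y, rfl⟩ := (AlgHom.mem_range φ).1 hx
      exact hall y
    · refine Algebra.adjoin_le ?_
      rintro x (hx | hx)
      · refine (AlgHom.mem_range φ).2 ⟨⟨x, hx⟩ ⊗ₜ 1, ?_⟩
        rw [hφ, Algebra.TensorProduct.lift_tmul, map_one, mul_one]; rfl
      · refine (AlgHom.mem_range φ).2 ⟨1 ⊗ₜ ⟨x, hx⟩, ?_⟩
        rw [hφ, Algebra.TensorProduct.lift_tmul, map_one, one_mul]; rfl
  haveI : IsSemisimpleRing ↥φ.range :=
    RingHom.isSemisimpleRing_of_surjective φ.rangeRestrict.toRingHom φ.rangeRestrict_surjective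
  exact (Subalgebra.equivOfEq _ _ hrange).toRingEquiv.isSemisimpleRing

end TensorSemisimple

variable {ι : Type} [Fintype ι] [DecidableEq ι] {E : Type} [NormedAddCommGroup E] [NormedSpace ℂ E]
  (P : (ι → ℝ) ≃L[ℝ] E)

/-! ## §0 Plumbing -/

section Helpers

omit [DecidableEq ι] in
/-- A simple subalgebra of `M_ι(ℚ)` forces `ι ≠ ∅`. [folklore] -/
private theorem nonempty_of_isSimpleRing'' [DecidableEq ι] (L : Subalgebra ℚ (Matrix ι ι ℚ)) [IsSimpleRing L] :
    Nonempty ι := by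
  by_contra h
  haveI : IsEmpty ι := not_nonempty_iff.1 h
  obtain ⟨x, y, hxy⟩ := exists_pair_ne ↥L
  exact hxy (Subtype.ext (Matrix.ext fun i _ => isEmptyElim i))

/-- `†` maps the rational centraliser of `End_ℚ(X)` to itself when `End_ℚ(X)` is `†`-stable. [folklore] -/
private theorem rosati_mem_centralizer_of_forall_rosati_mem' {G : Matrix ι ι ℚ} (hG : IsUnit G.det)
    (hGt : G.transpose = -G) (hE : ∀ a ∈ endAlgRat P, rosati G a ∈ endAlgRat P) {z : Matrix ι ι ℚ}
    (hz : z ∈ Subalgebra.centralizer ℚ (endAlgRat P : Set (Matrix ι ι ℚ))) :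
    rosati G z ∈ Subalgebra.centralizer ℚ (endAlgRat P : Set (Matrix ι ι ℚ)) := by
  rw [Subalgebra.mem_centralizer_iff] at hz ⊢
  intro a ha
  have h := congrArg (rosati G) (hz (rosati G a) (hE a ha))
  rw [rosati_mul hG, rosati_mul hG, rosati_rosati hG hGt] at h
  exact h.symm

omit [DecidableEq ι] in
/-- `B(Ax, y) = B(x, A†y)` for `B(x, y) = ᵗx G y`. [folklore] -/
private theorem toBilin_apply_mulVec_eq' [DecidableEq ι] {G : Matrix ι ι ℚ} (hG : IsUnit G.det) (A : Matrix ι ι ℚ)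
    (x y : ι → ℚ) : Matrix.toBilin' G (A *ᵥ x) y = Matrix.toBilin' G x (rosati G A *ᵥ y) := by
  rw [Matrix.toBilin'_apply', Matrix.toBilin'_apply', dotProduct_mulVec_rosati hG]

omit [DecidableEq ι] in
/-- For an alternating `G` the form `ᵗx G y` is `(-1)`-symmetric. [folklore] -/
private theorem toBilin_eps [DecidableEq ι] {G : Matrix ι ι ℚ} (hGt : G.transpose = -G) (x y : ι → ℚ) :
    Matrix.toBilin' G x y = (-1) * Matrix.toBilin' G y x := by
  rw [Matrix.toBilin'_apply', Matrix.toBilin'_apply', Matrix.dotProduct_mulVec y, ← Matrix.mulVec_transpose, hGt,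
    Matrix.neg_mulVec, neg_dotProduct, dotProduct_comm (G *ᵥ y) x, neg_one_mul, neg_neg]

/-- A subalgebra is reduced iff it contains no non-zero nilpotent element of the ambient algebra. [folklore] -/
private theorem isReduced_subalgebra_iff₅ {R : Type*} [CommSemiring R] {A : Type*} [Semiring A] [Algebra R A]
    (S : Subalgebra R A) : IsReduced S ↔ ∀ x ∈ S, IsNilpotent x → x = 0 := by
  constructor
  · rintro h x hx ⟨n, hn⟩
    have h0 : (⟨x, hx⟩ : S) = 0 :=
      h.eq_zero _ ⟨n, Subtype.ext (by rw [SubmonoidClass.coe_pow, ZeroMemClass.coe_zero]; exact hn)⟩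
    exact congrArg Subtype.val h0
  · intro h
    refine ⟨fun x hx => ?_⟩
    obtain ⟨n, hn⟩ := hx
    exact Subtype.ext (h x x.2 ⟨n, by rw [← SubmonoidClass.coe_pow, hn]; rfl⟩)

/-- FILE 2 transported to matrices: for a semisimple `†`-stable `S ≤ M_ι(ℚ)` (so that `ℚ^ι` is a semisimple
`S`-module on which `S` acts by `†`-adjointable operators for `ᵗx G y`), a `†`-STABLE commutative reduced
`T' ⊆ C(S)`, maximal commutative in `C(S)`. [cite: MilneCM2006, Ch. I §3 Exercise 3.10 (b) (p. 29)] -/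
private theorem exists_rosati_stable_commutant_maximal (S : Subalgebra ℚ (Matrix ι ι ℚ)) [IsSemisimpleRing ↥S]
    {G : Matrix ι ι ℚ} (hG : IsUnit G.det) (hGt : G.transpose = -G) (hSr : ∀ a ∈ S, rosati G a ∈ S) :
    ∃ T' : Subalgebra ℚ (Matrix ι ι ℚ), (∀ y ∈ T', ∀ c ∈ S, y * c = c * y) ∧ (∀ a ∈ T', ∀ b ∈ T', a * b = b * a) ∧
      IsReduced T' ∧ (∀ y : Matrix ι ι ℚ, (∀ c ∈ S, y * c = c * y) → (∀ t ∈ T', y * t = t * y) → y ∈ T') ∧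
      ∀ a ∈ T', rosati G a ∈ T' := by
  -- `V = ℚ^ι` is an `S`-module through `*ᵥ` (Mathlib's `Matrix.mulVec` action, inherited by the subalgebra `S`); the
  -- form `ᵗx G y` is non-degenerate, `(-1)`-symmetric, and `S` acts by `†`-adjointable operators
  have hBnd : (Matrix.toBilin' G).Nondegenerate :=
    Matrix.nondegenerate_toBilin'_iff.2 (Matrix.nondegenerate_iff_det_ne_zero.2 hG.ne_zero)
  have hε : ∀ v w : ι → ℚ, Matrix.toBilin' G v w = (-1) * Matrix.toBilin' G w v := toBilin_eps hGt
  -- FILE 2: an adjoint-stable commutative reduced `R ⊆ End_S(V)`, maximal commutative in `End_S(V)`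
  obtain ⟨R, hRS, hRcomm, hRred, hRmax, hRadj⟩ :=
    Commutant.exists_subalgebra_comm_reduced_maximal_adjoint_stable (F := ℚ) (S := ↥S) (V := ι → ℚ)
      (Matrix.toBilin' G) two_ne_zero hBnd hε
      (fun s ↦ ⟨⟨rosati G s, hSr _ s.2⟩, fun v w ↦ by
        show Matrix.toBilin' G ((s : Matrix ι ι ℚ) *ᵥ v) w = Matrix.toBilin' G v (rosati G s *ᵥ w)
        exact toBilin_apply_mulVec_eq' hG _ _ _⟩)
  -- `S`-linearity in `*ᵥ` form
  have hRS' : ∀ x ∈ R, ∀ c ∈ S, ∀ v : ι → ℚ, x (c *ᵥ v) = c *ᵥ x v := fun x hx c hc v ↦ by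
    have h := hRS x hx ⟨c, hc⟩ v
    exact h
  have hRmax' : ∀ f : Module.End ℚ (ι → ℚ), (∀ c ∈ S, ∀ v : ι → ℚ, f (c *ᵥ v) = c *ᵥ f v) →
      (∀ x ∈ R, f * x = x * f) → f ∈ R := fun f hf hfR ↦
    hRmax f (fun c v ↦ by
      show f ((c : Matrix ι ι ℚ) *ᵥ v) = (c : Matrix ι ι ℚ) *ᵥ f v
      exact hf c c.2 v) hfR
  -- transport `R ⊆ End(V)` to matrices
  let e : Module.End ℚ (ι → ℚ) ≃ₐ[ℚ] Matrix ι ι ℚ := LinearMap.toMatrixAlgEquiv'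
  have he : ∀ (f : Module.End ℚ (ι → ℚ)) (v : ι → ℚ), e f *ᵥ v = f v := fun f v ↦ LinearMap.toMatrix'_mulVec f v
  have hesymm : ∀ (M : Matrix ι ι ℚ) (v : ι → ℚ), e.symm M v = M *ᵥ v := fun M v ↦ by
    change Matrix.toLinAlgEquiv' M v = M *ᵥ v
    exact Matrix.toLinAlgEquiv'_apply M v
  let T' : Subalgebra ℚ (Matrix ι ι ℚ) := R.map (e : Module.End ℚ (ι → ℚ) →ₐ[ℚ] Matrix ι ι ℚ)
  have hmemT' : ∀ {y : Matrix ι ι ℚ}, y ∈ T' ↔ ∃ x ∈ R, e x = y := fun {y} ↦ Subalgebra.mem_map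
  -- `S`-linear endomorphisms vs. matrices commuting with `S`
  have hmat_of_lin : ∀ x ∈ R, ∀ c ∈ S, e x * c = c * e x := by
    intro x hx c hc
    rw [Matrix.ext_iff_mulVec]
    intro v
    rw [← Matrix.mulVec_mulVec, ← Matrix.mulVec_mulVec, he, he]
    exact hRS' x hx c hc v
  have hlin_of_mat : ∀ y : Matrix ι ι ℚ, (∀ c ∈ S, y * c = c * y) →
      ∀ c ∈ S, ∀ v : ι → ℚ, e.symm y (c *ᵥ v) = c *ᵥ e.symm y v := by
    intro y hy c hc v
    rw [hesymm, hesymm, Matrix.mulVec_mulVec, Matrix.mulVec_mulVec, hy c hc]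
  refine ⟨T', fun y hy c hc ↦ ?_, fun a ha b hb ↦ ?_, ?_, fun y hyS hyT ↦ ?_, fun a ha ↦ ?_⟩
  · obtain ⟨x, hx, rfl⟩ := hmemT'.1 hy
    exact hmat_of_lin x hx c hc
  · obtain ⟨x, hx, rfl⟩ := hmemT'.1 ha
    obtain ⟨y, hy, rfl⟩ := hmemT'.1 hb
    rw [← map_mul, ← map_mul, hRcomm x hx y hy]
  · haveI : IsReduced R := hRred
    exact isReduced_of_injective (Subalgebra.equivMapOfInjective R (e : Module.End ℚ (ι → ℚ) →ₐ[ℚ]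
      Matrix ι ι ℚ) e.injective).symm (AlgEquiv.injective _)
  · -- maximality: `e⁻¹ y` is `S`-linear and commutes with `R`
    have hmem : e.symm y ∈ R := by
      refine hRmax' _ (hlin_of_mat y hyS) fun x hx ↦ ?_
      apply e.injective
      rw [map_mul, map_mul, e.apply_symm_apply]
      exact hyT (e x) (hmemT'.2 ⟨x, hx, rfl⟩)
    exact hmemT'.2 ⟨e.symm y, hmem, e.apply_symm_apply y⟩
  · -- `†`-stable: the adjoint inside `R` is `†`
    obtain ⟨x, hx, rfl⟩ := hmemT'.1 ha
    obtain ⟨y, hy, hxy⟩ := hRadj x hx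
    suffices h : rosati G (e x) = e y by rw [h]; exact hmemT'.2 ⟨y, hy, rfl⟩
    rw [Matrix.ext_iff_mulVec]
    intro w
    refine sub_eq_zero.1 (hBnd.2 _ fun v ↦ ?_)
    rw [map_sub, ← toBilin_apply_mulVec_eq' hG, he, he, hxy, sub_self]

end Helpers

/-! ## §2 Exercise 3.10 (b) for every complex torus -/

section Torus

variable (L : Subalgebra ℚ (Matrix ι ι ℚ)) [IsSimpleRing L] {d : ℕ}

/-- ★★★ **EX. 3.10 (b) FOR EVERY COMPLEX TORUS: a ROSATI-STABLE `R` with `d · dim_ℚ R = 2 dim X` in `End_{ℚ,L}(X)`.**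
Let `G` be a rational alternating non-degenerate matrix under whose involution `A ↦ A† = G⁻¹ ᵗA G` the algebra
`End_ℚ(X)` is stable (every polarisation), `L ≤ End_ℚ(X)` a simple subalgebra of degree `d` over its centre which is
`†`-STABLE, and suppose `End_ℚ(X)` contains a commutative reduced subalgebra of dimension `2 dim X` (`X` has complex
multiplication).  Then `End_{ℚ,L}(X) = End_ℚ(X) ∩ C(L)` contains a commutative reduced `R` with `d · dim_ℚ R = 2 dim X`
which is STABLE UNDER `†` — «if `A` has complex multiplication, then there is an `R` as in (a) that is stabilized by
`′`».  [cite: MilneCM2006, Ch. I §3 Exercise 3.10 (b) (p. 29)] [cite: Cimpric2008FormallyRealInvolutions, §2 Lemma 5] -/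
theorem exists_rosati_stable_le_endAlgRat_inf_centralizer_mul_finrank_eq_card {G : Matrix ι ι ℚ}
    (hG : IsUnit G.det) (hGt : G.transpose = -G) (hE : ∀ a ∈ endAlgRat P, rosati G a ∈ endAlgRat P)
    (hLE : L ≤ endAlgRat P) (hd : finrank ℚ L = d ^ 2 * finrank ℚ ↥(Subalgebra.center ℚ ↥L))
    (hLr : ∀ a ∈ L, rosati G a ∈ L)
    (hex : ∃ T : Subalgebra ℚ (Matrix ι ι ℚ), T ≤ endAlgRat P ∧ IsReduced T ∧ (∀ a ∈ T, ∀ b ∈ T, a * b = b * a) ∧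
      finrank ℚ T = Fintype.card ι) :
    ∃ R : Subalgebra ℚ (Matrix ι ι ℚ), R ≤ endAlgRat P ⊓ Subalgebra.centralizer ℚ (L : Set (Matrix ι ι ℚ)) ∧
      (∀ x ∈ R, ∀ y ∈ R, x * y = y * x) ∧ IsReduced R ∧ d * finrank ℚ R = Fintype.card ι ∧
      ∀ a ∈ R, rosati G a ∈ R := by
  haveI : Nonempty ι := nonempty_of_isSimpleRing'' L
  obtain ⟨T, hTE, hTred, hTcomm, hTdim⟩ := hex
  haveI := hTred
  -- the rational commutant `Z` of `End_ℚ(X)`: `Z ⊆ T ⊆ End_ℚ(X)`, commutative, reduced, `†`-stable, `C(Z) ⊆ End_ℚ(X)`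
  set Zc : Subalgebra ℚ (Matrix ι ι ℚ) := Subalgebra.centralizer ℚ (endAlgRat P : Set (Matrix ι ι ℚ)) with hZcdef
  have hZT : Zc ≤ T := by
    intro z hz
    rw [← centralizer_eq_self_of_comm_isReduced T hTcomm hTdim, Subalgebra.mem_centralizer_iff]
    exact fun t ht ↦ (Subalgebra.mem_centralizer_iff ℚ).1 hz t (hTE ht)
  have hZE : Zc ≤ endAlgRat P := hZT.trans hTE
  have hZcomm : ∀ a ∈ Zc, ∀ b ∈ Zc, a * b = b * a := fun a ha b hb ↦
    (Subalgebra.mem_centralizer_iff ℚ).1 hb a (hZE ha)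
  haveI hZred : IsReduced Zc := by
    rw [isReduced_subalgebra_iff₅] at hTred ⊢
    exact fun z hz hn ↦ hTred z (hZT hz) hn
  have hZr : ∀ z ∈ Zc, rosati G z ∈ Zc := fun z hz ↦ rosati_mem_centralizer_of_forall_rosati_mem' P hG hGt hE hz
  have hCZ : Subalgebra.centralizer ℚ (Zc : Set (Matrix ι ι ℚ)) ≤ endAlgRat P :=
    centralizer_le_endAlgRat_of_jMatrix_mem_span P (jMatrix_mem_span_centralizer_endAlgRat P)
  have hLZ : ∀ l ∈ L, ∀ z ∈ Zc, l * z = z * l := fun l hl z hz ↦ (Subalgebra.mem_centralizer_iff ℚ).1 hz l (hLE hl)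
  -- the algebra `S = ℚ[L ∪ Z]`: `†`-stable and semisimple
  set S : Subalgebra ℚ (Matrix ι ι ℚ) := Algebra.adjoin ℚ ((L : Set (Matrix ι ι ℚ)) ∪ (Zc : Set (Matrix ι ι ℚ)))
    with hSdef
  have hLS : L ≤ S := fun x hx ↦ Algebra.subset_adjoin (Or.inl hx)
  have hZS : Zc ≤ S := fun x hx ↦ Algebra.subset_adjoin (Or.inr hx)
  have hSr : ∀ a ∈ S, rosati G a ∈ S := by
    refine AntiInvolution.adjoin_stable (rosatiLinear G) (fun x y ↦ rosati_mul hG x y) (rosati_rosati hG hGt) ?_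
    rintro x (hx | hx)
    · exact Algebra.subset_adjoin (Or.inl (hLr x hx))
    · exact Algebra.subset_adjoin (Or.inr (hZr x hx))
  haveI : IsSemisimpleRing ↥L := by
    haveI : IsArtinianRing ↥L := IsArtinianRing.of_finite ℚ _
    infer_instance
  haveI : IsSemisimpleRing ↥S := isSemisimpleRing_adjoin_union_of_comm_isReduced L Zc hZcomm hLZ
  -- elements commuting with `L` and `Zc` commute with `S`
  have hcommS : ∀ y : Matrix ι ι ℚ, (∀ l ∈ L, y * l = l * y) → (∀ z ∈ Zc, y * z = z * y) → ∀ c ∈ S, y * c = c * y := by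
    intro y hyL hyZ c hc
    refine (Algebra.commute_of_mem_adjoin_of_forall_mem_commute hc ?_).eq
    rintro b (hb | hb)
    · exact hyL b hb
    · exact hyZ b hb
  -- FILE 2 on matrices: a `†`-stable commutative reduced `T' ⊆ C(S)`, maximal commutative in `C(S)`
  obtain ⟨T', hT'S, hT'comm, hT'red, hT'max, hT'r⟩ := exists_rosati_stable_commutant_maximal S hG hGt hSr
  haveI := hT'red
  -- `T' ⊆ C(S) ⊆ End_{ℚ,L}(X)`
  have hT'le : T' ≤ endAlgRat P ⊓ Subalgebra.centralizer ℚ (L : Set (Matrix ι ι ℚ)) := by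
    intro y hy
    refine Algebra.mem_inf.2 ⟨hCZ ?_, ?_⟩
    · rw [Subalgebra.mem_centralizer_iff]
      exact fun z hz ↦ (hT'S y hy z (hZS hz)).symm
    · rw [Subalgebra.mem_centralizer_iff]
      exact fun l hl ↦ (hT'S y hy l (hLS hl)).symm
  -- MAXIMALITY: `Zc ⊆ T'`, and a matrix commuting with `L` and with `T'` lies in `T'`
  have hZT' : Zc ≤ T' := fun z hz ↦
    hT'max z (hcommS z (fun l hl ↦ (hLZ l hl z hz).symm) (fun z' hz' ↦ hZcomm z hz z' hz'))
      (fun t ht ↦ (hT'S t ht z (hZS hz)).symm)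
  have hmaxT' : ∀ y ∈ Subalgebra.centralizer ℚ (L : Set (Matrix ι ι ℚ)), (∀ t ∈ T', y * t = t * y) → y ∈ T' :=
    fun y hy hyT ↦ hT'max y
      (hcommS y (fun l hl ↦ ((Subalgebra.mem_centralizer_iff ℚ).1 hy l hl).symm) (fun z hz ↦ hyT z (hZT' hz))) hyT
  -- DIMENSION: `T'` is a maximal étale subalgebra of the simple algebra `C(L)`, so `dim T' = [C(L)]_red = #ι / d`
  have hT'dim : d * finrank ℚ T' = Fintype.card ι := by
    set C : Subalgebra ℚ (Matrix ι ι ℚ) := Subalgebra.centralizer ℚ (L : Set (Matrix ι ι ℚ)) with hCdef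
    haveI : IsSimpleRing ↥C := isSimpleRing_centralizer L
    have hT'C : T' ≤ C := fun y hy ↦ (Algebra.mem_inf.1 (hT'le hy)).2
    set R' : Subalgebra ℚ ↥C := T'.comap C.val with hR'def
    have hmem : ∀ x : ↥C, x ∈ R' ↔ (x : Matrix ι ι ℚ) ∈ T' := fun x ↦ Subalgebra.mem_comap _ _ _
    have hR'comm : ∀ x ∈ R', ∀ y ∈ R', x * y = y * x := fun x hx y hy ↦
      Subtype.ext (hT'comm _ ((hmem x).1 hx) _ ((hmem y).1 hy))
    have hR'red : IsReduced ↥R' := by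
      rw [isReduced_subalgebra_iff₅] at hT'red ⊢
      intro x hx hn'
      obtain ⟨m, hm⟩ := hn'
      exact Subtype.ext (hT'red _ ((hmem x).1 hx) ⟨m, by rw [← SubmonoidClass.coe_pow, hm]; rfl⟩)
    have hdim : finrank ℚ ↥R' = finrank ℚ T' := by
      let ψ : ↥R' →ₗ[ℚ] ↥T' :=
        { toFun := fun x => ⟨((x : ↥C) : Matrix ι ι ℚ), (hmem x).1 x.2⟩
          map_add' := fun x y => rfl
          map_smul' := fun r x => rfl }
      have hψ : Function.Bijective ψ := by
        constructor
        · intro x y hxy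
          exact Subtype.ext (Subtype.ext (congrArg (fun z : ↥T' => (z : Matrix ι ι ℚ)) hxy))
        · intro y
          exact ⟨⟨⟨(y : Matrix ι ι ℚ), hT'C y.2⟩, (hmem _).2 y.2⟩, rfl⟩
      exact (LinearEquiv.ofBijective ψ hψ).finrank_eq
    have hmax : Maximal (fun S' : Subalgebra ℚ ↥C => (∀ x ∈ S', ∀ y ∈ S', x * y = y * x) ∧ IsReduced S') R' := by
      refine ⟨⟨hR'comm, hR'red⟩, fun S' hS' hR'S' y hy ↦ ?_⟩
      rw [hmem]
      refine hmaxT' (y : Matrix ι ι ℚ) y.2 fun t ht ↦ ?_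
      have h := hS'.1 y hy ⟨t, hT'C ht⟩ (hR'S' ((hmem ⟨t, hT'C ht⟩).2 ht))
      exact congrArg (fun z : ↥C ↦ (z : Matrix ι ι ℚ)) h
    have h1 := (finrank_eq_reducedDegree_and_center_le_of_maximal_of_isSimpleRing R' hmax).1
    have h2 := Matrix.mul_reducedDegree_centralizer_eq_card L hd
    rw [← hdim, h1]
    exact h2
  exact ⟨T', hT'le, hT'comm, hT'red, hT'dim, hT'r⟩

/-- **EX. 3.10 (b), with «complex multiplication» as Milne's Def. 3.2 `[End_ℚ(X) : ℚ]_red = 2 dim X`.**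
[cite: MilneCM2006, Ch. I §3 Exercise 3.10 (b) (p. 29), Def. 3.2 (p. 27)] -/
theorem exists_rosati_stable_le_endAlgRat_inf_centralizer_mul_finrank_eq_card_of_reducedDegree_eq_card
    {G : Matrix ι ι ℚ} (hG : IsUnit G.det) (hGt : G.transpose = -G) (hE : ∀ a ∈ endAlgRat P, rosati G a ∈ endAlgRat P)
    (hLE : L ≤ endAlgRat P) (hd : finrank ℚ L = d ^ 2 * finrank ℚ ↥(Subalgebra.center ℚ ↥L))
    (hLr : ∀ a ∈ L, rosati G a ∈ L) (h : reducedDegree ℚ ↥(endAlgRat P) = Fintype.card ι) :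
    ∃ R : Subalgebra ℚ (Matrix ι ι ℚ), R ≤ endAlgRat P ⊓ Subalgebra.centralizer ℚ (L : Set (Matrix ι ι ℚ)) ∧
      (∀ x ∈ R, ∀ y ∈ R, x * y = y * x) ∧ IsReduced R ∧ d * finrank ℚ R = Fintype.card ι ∧
      ∀ a ∈ R, rosati G a ∈ R :=
  exists_rosati_stable_le_endAlgRat_inf_centralizer_mul_finrank_eq_card P L hG hGt hE hLE hd hLr
    ((reducedDegree_endAlgRat_eq_card_iff_exists_comm_isReduced P).1 h)

/-- ★ **EX. 3.10 (a) + (b) AS AN EQUIVALENCE, for every complex torus and every Rosati involution stabilising `End_ℚ(X)`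
and `L`**: `[End_ℚ(X) : ℚ]_red = 2 dim X` iff `End_{ℚ,L}(X)` contains a `†`-STABLE commutative reduced `R` with
`d · dim_ℚ R = 2 dim X` («equality holds for some `R` if and only if `A` has complex multiplication … that is stabilized
by `′`»; ⟸ is A3-G143's `reducedDegree_endAlgRat_eq_card_of_mul_finrank_eq_card`). [cite: MilneCM2006, Ch. I §3 Exercise 3.10 (a)(b) (p. 29)] -/
theorem exists_rosati_stable_mul_finrank_eq_card_iff_reducedDegree_endAlgRat_eq_card {G : Matrix ι ι ℚ}
    (hG : IsUnit G.det) (hGt : G.transpose = -G) (hE : ∀ a ∈ endAlgRat P, rosati G a ∈ endAlgRat P)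
    (hLE : L ≤ endAlgRat P) (hd : finrank ℚ L = d ^ 2 * finrank ℚ ↥(Subalgebra.center ℚ ↥L))
    (hLr : ∀ a ∈ L, rosati G a ∈ L) :
    (∃ R : Subalgebra ℚ (Matrix ι ι ℚ), R ≤ endAlgRat P ⊓ Subalgebra.centralizer ℚ (L : Set (Matrix ι ι ℚ)) ∧
      (∀ x ∈ R, ∀ y ∈ R, x * y = y * x) ∧ IsReduced R ∧ d * finrank ℚ R = Fintype.card ι ∧
      ∀ a ∈ R, rosati G a ∈ R) ↔ reducedDegree ℚ ↥(endAlgRat P) = Fintype.card ι := by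
  refine ⟨fun ⟨R, hRle, hRcomm, hRred, hRdim, _⟩ ↦ ?_,
    exists_rosati_stable_le_endAlgRat_inf_centralizer_mul_finrank_eq_card_of_reducedDegree_eq_card P L hG hGt hE
      hLE hd hLr⟩
  haveI := hRred
  exact reducedDegree_endAlgRat_eq_card_of_mul_finrank_eq_card P L hLE hd R hRcomm hRle hRdim

end Torus

/-! ## §3 For a polarised complex torus / an abelian variety -/

section Polarised

variable {P} (L : Subalgebra ℚ (Matrix ι ι ℚ)) [IsSimpleRing L] {d : ℕ}

/-- ★★ **EX. 3.10 (b) FOR A POLARISED COMPLEX TORUS `(X, η)` AND ANY RATIONAL GRAM MATRIX `G` OF `η`**: if `X` has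
complex multiplication and the simple `L ≤ End_ℚ(X)` (degree `d` over its centre) is stable under the Rosati
involution `†_η`, then `End_{ℚ,L}(X)` contains a commutative reduced `R` with `d · dim_ℚ R = 2 dim X` stable under
`†_η` (`End_ℚ(X)` is `†_η`-stable by Lemma 2.4.1, the tree's `rosati_mem_endAlgRat`). [cite: MilneCM2006, Ch. I §3 Exercise 3.10 (b) (p. 29)] [cite: Lange2023AbelianVarietiesComplex, §2.4.1 Lemma 2.4.1] -/
theorem IsRiemannForm.exists_rosati_stable_le_endAlgRat_inf_centralizer_mul_finrank_eq_card
    {η : E [⋀^Fin 2]→L[ℝ] ℝ} (hη : IsRiemannForm P η) {G : Matrix ι ι ℚ}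
    (hGr : G.map (Rat.cast : ℚ → ℝ) = latticeGram P η) (hLE : L ≤ endAlgRat P)
    (hd : finrank ℚ L = d ^ 2 * finrank ℚ ↥(Subalgebra.center ℚ ↥L)) (hLr : ∀ a ∈ L, rosati G a ∈ L)
    (hex : ∃ T : Subalgebra ℚ (Matrix ι ι ℚ), T ≤ endAlgRat P ∧ IsReduced T ∧ (∀ a ∈ T, ∀ b ∈ T, a * b = b * a) ∧
      finrank ℚ T = Fintype.card ι) :
    ∃ R : Subalgebra ℚ (Matrix ι ι ℚ), R ≤ endAlgRat P ⊓ Subalgebra.centralizer ℚ (L : Set (Matrix ι ι ℚ)) ∧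
      (∀ x ∈ R, ∀ y ∈ R, x * y = y * x) ∧ IsReduced R ∧ d * finrank ℚ R = Fintype.card ι ∧
      ∀ a ∈ R, rosati G a ∈ R :=
  Literature.NumberTheory.ComplexMultiplication.exists_rosati_stable_le_endAlgRat_inf_centralizer_mul_finrank_eq_card
    P L (isUnit_det_of_map_ratCast hGr hη.isUnit_det_latticeGram) (transpose_eq_neg_of_map_ratCast P hGr)
    (fun _ ha ↦ rosati_mem_endAlgRat P hη.1 hη.2.2 hGr ha) hLE hd hLr hex

/-- **The polarised iff**: for `(X, η)` polarised, `G` a rational Gram matrix of `η` and `L` `†_η`-stable,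
`[End_ℚ(X) : ℚ]_red = 2 dim X` iff `End_{ℚ,L}(X)` contains a `†_η`-stable commutative reduced `R` with
`d · dim_ℚ R = 2 dim X`. [cite: MilneCM2006, Ch. I §3 Exercise 3.10 (a)(b) (p. 29)] -/
theorem IsRiemannForm.exists_rosati_stable_mul_finrank_eq_card_iff_reducedDegree_endAlgRat_eq_card
    {η : E [⋀^Fin 2]→L[ℝ] ℝ} (hη : IsRiemannForm P η) {G : Matrix ι ι ℚ}
    (hGr : G.map (Rat.cast : ℚ → ℝ) = latticeGram P η) (hLE : L ≤ endAlgRat P)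
    (hd : finrank ℚ L = d ^ 2 * finrank ℚ ↥(Subalgebra.center ℚ ↥L)) (hLr : ∀ a ∈ L, rosati G a ∈ L) :
    (∃ R : Subalgebra ℚ (Matrix ι ι ℚ), R ≤ endAlgRat P ⊓ Subalgebra.centralizer ℚ (L : Set (Matrix ι ι ℚ)) ∧
      (∀ x ∈ R, ∀ y ∈ R, x * y = y * x) ∧ IsReduced R ∧ d * finrank ℚ R = Fintype.card ι ∧
      ∀ a ∈ R, rosati G a ∈ R) ↔ reducedDegree ℚ ↥(endAlgRat P) = Fintype.card ι :=
  Literature.NumberTheory.ComplexMultiplication.exists_rosati_stable_mul_finrank_eq_card_iff_reducedDegree_endAlgRat_eq_card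
    P L (isUnit_det_of_map_ratCast hGr hη.isUnit_det_latticeGram) (transpose_eq_neg_of_map_ratCast P hGr)
    (fun _ ha ↦ rosati_mem_endAlgRat P hη.1 hη.2.2 hGr ha) hLE hd hLr

end Polarised

end Literature.NumberTheory.ComplexMultiplication
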